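import Literature.Computability.AlgebraicComplexity.BI17GenericTernaryCubicNonNormal
import HarnessLib

/-!
# `a(4,4) = a'(4,4) = 1`: almost all quaternary quartics have stabilizer period `1`
# (BI 2017 Thm. 2.3 at `(D, m) = (4, 4)`, from `E(4,4)` alone)

Sibling proof file of `Literature/Computability/AlgebraicComplexity/BI17FundamentalInvariantForms.lean`
(cell `val-lit`, DAG row BI2017-A). Bürgisser–Ikenmeyer 2017 Thm. 2.3: "`a'(D,m) = 1` except
`a'(3,2) = a'(3,3) = 2` [and the refuted `a'(4,3) = 2`]". The `(4, 4)` entry (quartic surfaces) follows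
from the generic degree monoid `E(4,4) = ℕ ∖ {1,2,3,5,9}` (Example 3.7, tree theorem
`genericDegreeMonoid_four_four`, val-lit-p4) by the degree argument of
`BI17GenericTernaryCubicNonNormal.lean`: an `SL₄`-invariant of degree `d` transforms under `stab(w)` by
`det^{4d/4} = det^d` (t09's `IsSLInvariantCoord.aeval_formCoeff_linSubstRep_eq_det_pow`), so off the
zero sets of non-zero invariants of the coprime degrees `4` and `7` every stabilizer element has
`det⁴ = det⁷ = 1`, i.e. `det = 1`: `det(stab w) = {1}`, `a(w) = 1`, `a'(w) = 1` — WITHOUT the generic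
trivial-stabilizer theorem (Matsumura–Monsky), which is not in the tree.

* `det_pow_eq_one_of_mem_linStabilizer_of_invariant` — general `(D, m)`: `det(g)^n = 1` for
  `g ∈ stab(w)` whenever an `SL_m`-invariant of degree `d`, `D d = m n`, does not vanish at `w`;
* `isZariskiGeneric_stabilizerPeriod_eq_one_four_four`, `isZariskiGeneric_reducedStabilizerPeriod_eq_one_four_four`,
  `BI2017_thm_2_3_period_four_four` (the `(4,4)` instance of the refuted-as-a-whole typed conjunction);
* `isZariskiGeneric_not_isIntegrallyClosed_orbitCoordRing_four_four_of_polystable` — Cor. 3.17 (1)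
  at `(4,4)` CONDITIONAL on generic polystability of quartic surfaces (`a(w) = 1 < 4`; the `(4,4)`
  slice of Prop. 2.10 is not in the tree).

Everything PROVED; no definitions, no facts; nothing here bears on `VP` versus `VNP`.
-/

noncomputable section

open MvPolynomial

namespace Literature.Computability.AlgebraicComplexity

/-- **`det(g)^n = 1` on the stabilizer, from one non-vanishing invariant** (general `(D, m)`): if an
`SL_m`-invariant `F` of degree `d` with `D d = m n` does not vanish at the form `w` of degree `D`, every
`g ∈ stab(w)` has `det(g)^n = 1` (`F(g·w) = det(g)^n F(w)`, BI Lemma 3.2 (1), proof).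
[cite: BurgisserIkenmeyer2017, Lemma 3.2 (1) (proof)] -/
theorem det_pow_eq_one_of_mem_linStabilizer_of_invariant {m D : ℕ} (hm : 0 < m)
    {w : MvPolynomial (Fin m) ℂ} (hw : w.IsHomogeneous D)
    {F : MvPolynomial (DegIdx (Fin m) D) ℂ} {d n : ℕ} (hFd : F.IsHomogeneous d)
    (hFi : IsSLInvariantCoord D F) (hn : D * d = m * n) (hFw : aeval (formCoeff D w) F ≠ 0)
    {g : GL (Fin m) ℂ} (hg : g ∈ linStabilizer w) :
    ((Matrix.GeneralLinearGroup.det g : ℂˣ) : ℂ) ^ n = 1 := by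
  have h := hFi.aeval_formCoeff_linSubstRep_eq_det_pow hm hw hFd hn g
  have hgw : linSubstRep (Fin m) ℂ g w = w := hg
  rw [hgw] at h
  exact mul_right_cancel₀ hFw (h.symm.trans (one_mul _).symm)

/-- Non-zero `SL₄`-invariants of quaternary quartics exist in every degree `d ∉ {1,2,3,5,9}`
(tree: `genericDegreeMonoid_four_four`). [cite: BurgisserIkenmeyer2017, Ex. 3.7] -/
theorem exists_isSLInvariantCoord_four_four {d : ℕ} (h1 : d ≠ 1) (h2 : d ≠ 2) (h3 : d ≠ 3)
    (h5 : d ≠ 5) (h9 : d ≠ 9) :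
    ∃ F : MvPolynomial (DegIdx (Fin 4) 4) ℂ, F.IsHomogeneous d ∧ IsSLInvariantCoord 4 F ∧ F ≠ 0 := by
  have h : d ∈ genericDegreeMonoid (Fin 4) ℂ 4 := by
    rw [genericDegreeMonoid_four_four]
    exact ⟨h1, h2, h3, h5, h9⟩
  exact h

/-- **`det(stab w) = {1}`** for a quaternary quartic at which some `SL₄`-invariants of the coprime
degrees `4` and `7` do not vanish. [cite: BurgisserIkenmeyer2017, Thm. 2.3 ("a'(D,m) = 1")] -/
theorem stabilizerDetImage_eq_bot_four_four {w : MvPolynomial (Fin 4) ℂ} (hw : w.IsHomogeneous 4)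
    {F₄ F₇ : MvPolynomial (DegIdx (Fin 4) 4) ℂ} (h₄d : F₄.IsHomogeneous 4) (h₄i : IsSLInvariantCoord 4 F₄)
    (h₇d : F₇.IsHomogeneous 7) (h₇i : IsSLInvariantCoord 4 F₇) (h₄w : aeval (formCoeff 4 w) F₄ ≠ 0)
    (h₇w : aeval (formCoeff 4 w) F₇ ≠ 0) : stabilizerDetImage w = ⊥ := by
  rw [eq_bot_iff]
  intro u hu
  rw [mem_stabilizerDetImage_iff] at hu
  obtain ⟨g, hg, rfl⟩ := hu
  rw [Subgroup.mem_bot, Units.ext_iff, Units.val_one]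
  have h4 := det_pow_eq_one_of_mem_linStabilizer_of_invariant (n := 4) (by norm_num) hw h₄d h₄i
    (by norm_num) h₄w hg
  have h7 := det_pow_eq_one_of_mem_linStabilizer_of_invariant (n := 7) (by norm_num) hw h₇d h₇i
    (by norm_num) h₇w hg
  set δ := ((Matrix.GeneralLinearGroup.det g : ℂˣ) : ℂ)
  -- `δ = δ⁸ / δ⁷ = (δ⁴)² / δ⁷`
  have : δ * δ ^ 7 = (δ ^ 4) ^ 2 := by ring
  rw [h4, h7, one_pow, mul_one] at this
  exact this

/-- **BI 2017 Thm. 2.3 at `(4, 4)`, the value `a(4,4) = 1`: almost all quaternary quartics have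
stabilizer period `1`** (`det(stab w) = {1}` off the zero sets of two invariants of degrees `4`, `7`).
[cite: BurgisserIkenmeyer2017, Thm. 2.3 ("a'(D,m) = 1")] -/
theorem isZariskiGeneric_stabilizerPeriod_eq_one_four_four :
    IsZariskiGeneric 4 fun w : MvPolynomial (Fin 4) ℂ => stabilizerPeriod w = 1 := by
  obtain ⟨F₄, h₄d, h₄i, h₄0⟩ := exists_isSLInvariantCoord_four_four (d := 4)
    (by decide) (by decide) (by decide) (by decide) (by decide)
  obtain ⟨F₇, h₇d, h₇i, h₇0⟩ := exists_isSLInvariantCoord_four_four (d := 7)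
    (by decide) (by decide) (by decide) (by decide) (by decide)
  have hgen : IsZariskiGeneric 4 fun w : MvPolynomial (Fin 4) ℂ =>
      aeval (formCoeff 4 w) F₄ ≠ 0 ∧ aeval (formCoeff 4 w) F₇ ≠ 0 :=
    IsZariskiGeneric.and ⟨F₄, h₄0, fun _ _ h => h⟩ ⟨F₇, h₇0, fun _ _ h => h⟩
  refine hgen.mono fun w hw h => ?_
  rw [stabilizerPeriod_def, stabilizerDetImage_eq_bot_four_four hw h₄d h₄i h₇d h₇i h.1 h.2,
    Subgroup.card_bot]

/-- **`a'(4,4) = 1`** (BI Thm. 2.3): almost all quaternary quartics have reduced stabilizer period `1`.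
[cite: BurgisserIkenmeyer2017, Thm. 2.3 ("a'(D,m) = 1")] -/
theorem isZariskiGeneric_reducedStabilizerPeriod_eq_one_four_four :
    IsZariskiGeneric 4 fun w : MvPolynomial (Fin 4) ℂ => reducedStabilizerPeriod 4 w = 1 := by
  refine isZariskiGeneric_stabilizerPeriod_eq_one_four_four.mono fun w _ h => ?_
  rw [reducedStabilizerPeriod, h, Fintype.card_fin]
  decide

/-- **The `(D, m) = (4, 4)` instance of the (refuted-as-a-whole) typed `BI2017_thm_2_3_period`
holds**: the printed case distinction evaluates to `1` at `(4, 4)`.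
[cite: BurgisserIkenmeyer2017, Thm. 2.3 ("a'(D,m) = 1")] -/
theorem BI2017_thm_2_3_period_four_four :
    IsZariskiGeneric 4 fun f : MvPolynomial (Fin 4) ℂ =>
      reducedStabilizerPeriod 4 f =
        if (4 = 3 ∧ 4 = 2) ∨ (4 = 3 ∧ 4 = 3) ∨ (4 = 4 ∧ 4 = 3) then 2 else 1 := by
  refine isZariskiGeneric_reducedStabilizerPeriod_eq_one_four_four.mono fun f _ h => ?_
  rw [h]
  decide

/-- **Cor. 3.17 (1) at `(4, 4)`, conditional on the `(4,4)` slice of Prop. 2.10**: if almost all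
quaternary quartics are polystable, then almost all have a NON-normal `GL₄`-orbit closure
(`a(w) = 1 < 4 = D`, t09's `BI2017_cor_3_17_1`). [cite: BurgisserIkenmeyer2017, Cor. 3.17 (1)] -/
theorem isZariskiGeneric_not_isIntegrallyClosed_orbitCoordRing_four_four_of_polystable
    (hpoly : IsZariskiGeneric 4 (IsPolystable : MvPolynomial (Fin 4) ℂ → Prop)) :
    IsZariskiGeneric 4 fun w : MvPolynomial (Fin 4) ℂ => ¬ IsIntegrallyClosed (OrbitCoordRing w 4) := by
  obtain ⟨F₄, h₄d, h₄i, h₄0⟩ := exists_isSLInvariantCoord_four_four (d := 4)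
    (by decide) (by decide) (by decide) (by decide) (by decide)
  have hgen := (isZariskiGeneric_stabilizerPeriod_eq_one_four_four.and hpoly).and
    (⟨F₄, h₄0, fun _ _ h => h⟩ :
      IsZariskiGeneric 4 fun w : MvPolynomial (Fin 4) ℂ => aeval (formCoeff 4 w) F₄ ≠ 0)
  refine hgen.mono fun w hw h => ?_
  obtain ⟨⟨h1, hps⟩, h₄w⟩ := h
  have hw0 : w ≠ 0 := by
    rintro rfl
    apply h₄w
    -- `F₄` is homogeneous of positive degree, so it vanishes at the origin `formCoeff 4 0 = 0`
    have h0 : formCoeff 4 (0 : MvPolynomial (Fin 4) ℂ) = 0 := by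
      funext d
      rw [formCoeff_apply, coeff_zero, Pi.zero_apply]
    have hc : constantCoeff F₄ = 0 := by
      rw [constantCoeff_eq]
      exact h₄d.coeff_eq_zero (by simp)
    rw [h0, MvPolynomial.aeval_zero, hc, map_zero]
  exact BI2017_cor_3_17_1 (by norm_num) hw hw0 hps (by rw [h1]; norm_num)

end Literature.Computability.AlgebraicComplexity

end
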